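import Literature.AlgebraicGeometry.Morphisms.ClosedImmersionNearFibreFlexible
import HarnessLib

/-!
# Being a closed immersion is a fibrewise condition for morphisms out of a proper scheme (EGA III 4.6.7 (ii), global form)

Topic `AlgebraicGeometry/Morphisms`; namespace `Literature.AlgebraicGeometry.Morphisms`. THEOREMS ONLY (no definition, no
named fact, no instance, no `sorry`).

Let `f : X → S` be PROPER, `q : P → S` SEPARATED and `g : X → P` an `S`-morphism (`g ≫ q = f`). Then `g` is a closed
immersion as soon as it is one on every fibre — in any of the three fibre dialects of the tree:

* `isClosedImmersion_of_forall_fiber` — the scheme-theoretic fibre `g⁻¹(p) → Spec κ(p)` at EVERY point `p` of `P` is a closed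
  immersion (Mathlib `Scheme.Hom.fiberToSpecResidueField`);
* `isClosedImmersion_of_forall_fiberHom` — for every `s ∈ S` a morphism of fibres `X_s → P_s` compatible with the
  projections (Mathlib `Scheme.Hom.fiber`) is a closed immersion;
* `isClosedImmersion_of_forall_isPullback` — for every `s ∈ S` the fibres are presented by ARBITRARY cartesian squares over
  some `ι₀ : S₀ → S` through which `Spec κ(s) → S` factors, with a compatible closed immersion `X₀ → P₀`;

and conversely (`isClosedImmersion_fiberToSpecResidueField`, `isClosedImmersion_iff_forall_fiber`: closed immersions are
stable under base change). Proof: ★ `Morphisms/ClosedImmersionNearFibre` (EGA III 4.6.7 (ii): closed immersion over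
`q⁻¹(U_s)` for an open `U_s ∋ s`) at every `s`, and closed immersions are Zariski-local on the target (the `q⁻¹(U_s)` cover
`P`). This is the form used when a morphism of proper `T`-schemes into `ℙ^m_T` is shown to be an embedding by checking the
geometric fibres (Mumford–Fogarty–Kirwan, Ch. 7 §2, construction of the moduli point of a polarised abelian scheme).

Cell `hodgecm-mathlib`, F-DAG (h2)/(F-6) capital (B-p20 (g11)); count-neutral (HC_CM is proved only modulo the 7 printed
citations until rung 0 closes).

## References
* A. Grothendieck, J. Dieudonné, *EGA III₁* (Publ. Math. IHÉS 11, 1961), Prop. 4.6.7 (ii). [EGAIII1]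
* The Stacks project, Tag 02UP (fibres of morphisms; context). [StacksProject]
-/

universe u

open CategoryTheory CategoryTheory.Limits AlgebraicGeometry TopologicalSpace

namespace Literature.AlgebraicGeometry.Morphisms

section Fibrewise

variable {X P S : Scheme.{u}} (f : X ⟶ S) (q : P ⟶ S) (g : X ⟶ P)

omit f q in
/-- A closed immersion has closed-immersion scheme-theoretic fibres `g⁻¹(p) → Spec κ(p)` (base change).
[cite: EGAIII1, Prop. 4.6.7 (ii)] -/
theorem isClosedImmersion_fiberToSpecResidueField [IsClosedImmersion g] (p : P) :
    IsClosedImmersion (g.fiberToSpecResidueField p) :=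
  MorphismProperty.pullback_snd (P := @IsClosedImmersion) _ _ inferInstance

/-- **A morphism from a proper `S`-scheme to a separated `S`-scheme is a closed immersion iff all its scheme-theoretic fibres
`g⁻¹(p) → Spec κ(p)` are** (EGA III 4.6.7 (ii) at every point of `S`, glued: closed immersions are local on the target).
[cite: EGAIII1, Prop. 4.6.7 (ii)] -/
theorem isClosedImmersion_of_forall_fiber (hg : g ≫ q = f) [IsProper f] [IsSeparated q]
    (H : ∀ p : P, IsClosedImmersion (g.fiberToSpecResidueField p)) : IsClosedImmersion g := by
  have hloc : ∀ s : S, ∃ U : S.Opens, s ∈ U ∧ IsClosedImmersion (g ∣_ q ⁻¹ᵁ U) := fun s ↦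
    exists_isClosedImmersion_morphismRestrict_preimage_of_fiber f q g hg s fun p _ ↦ H p
  choose U hsU hU using hloc
  have hcov : (⨆ s, U s) = ⊤ := top_le_iff.mp fun s _ ↦ Opens.mem_iSup.mpr ⟨s, hsU s⟩
  refine IsZariskiLocalAtTarget.of_iSup_eq_top (fun s : S ↦ q ⁻¹ᵁ U s) ?_ hU
  rw [← Scheme.Hom.preimage_iSup, hcov, Scheme.Hom.preimage_top]

/-- The `iff` form of `isClosedImmersion_of_forall_fiber`. [cite: EGAIII1, Prop. 4.6.7 (ii)] -/
theorem isClosedImmersion_iff_forall_fiber (hg : g ≫ q = f) [IsProper f] [IsSeparated q] :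
    IsClosedImmersion g ↔ ∀ p : P, IsClosedImmersion (g.fiberToSpecResidueField p) :=
  ⟨fun _ p ↦ isClosedImmersion_fiberToSpecResidueField g p, isClosedImmersion_of_forall_fiber f q g hg⟩

/-- **Fibre-morphism form**: if for every `s ∈ S` some morphism of fibres `X_s → P_s` compatible with the projections to
`X`, `P` and `Spec κ(s)` is a closed immersion, then `g` is a closed immersion (`f` proper, `q` separated).
[cite: EGAIII1, Prop. 4.6.7 (ii)] -/
theorem isClosedImmersion_of_forall_fiberHom (hg : g ≫ q = f) [IsProper f] [IsSeparated q]
    (gs : ∀ s : S, f.fiber s ⟶ q.fiber s) (h₁ : ∀ s, gs s ≫ q.fiberι s = f.fiberι s ≫ g)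
    (h₂ : ∀ s, gs s ≫ q.fiberToSpecResidueField s = f.fiberToSpecResidueField s)
    (hgs : ∀ s, IsClosedImmersion (gs s)) : IsClosedImmersion g :=
  isClosedImmersion_of_forall_fiber f q g hg fun p ↦
    isClosedImmersion_fiberToSpecResidueField_of_fiber f q g hg (q p) (gs (q p)) (h₁ _) (h₂ _) (hgs _) p rfl

/-- **Flexible fibre presentations**: if for every `s ∈ S` the fibres of `f` and `q` are presented by cartesian squares over
some `ι₀ : S₀ → S` through which `Spec κ(s) → S` factors, with a compatible closed immersion `g₀ : X₀ → P₀`, then `g` is a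
closed immersion (`f` proper, `q` separated). [cite: EGAIII1, Prop. 4.6.7 (ii)] -/
theorem isClosedImmersion_of_forall_isPullback (hg : g ≫ q = f) [IsProper f] [IsSeparated q]
    (H : ∀ s : S, ∃ (S₀ X₀ P₀ : Scheme.{u}) (ι₀ : S₀ ⟶ S) (σ : Spec (S.residueField s) ⟶ S₀)
      (_ : σ ≫ ι₀ = S.fromSpecResidueField s) (iX : X₀ ⟶ X) (f₀ : X₀ ⟶ S₀) (_ : IsPullback iX f₀ f ι₀)
      (iP : P₀ ⟶ P) (q₀ : P₀ ⟶ S₀) (_ : IsPullback iP q₀ q ι₀) (g₀ : X₀ ⟶ P₀) (_ : g₀ ≫ iP = iX ≫ g)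
      (_ : g₀ ≫ q₀ = f₀), IsClosedImmersion g₀) : IsClosedImmersion g := by
  have hloc : ∀ s : S, ∃ U : S.Opens, s ∈ U ∧ IsClosedImmersion (g ∣_ q ⁻¹ᵁ U) := fun s ↦ by
    obtain ⟨S₀, X₀, P₀, ι₀, σ, hσ, iX, f₀, HX, iP, q₀, HP, g₀, h₁, h₂, hg₀⟩ := H s
    exact exists_isClosedImmersion_morphismRestrict_preimage_of_isPullback f q g hg s σ hσ HX HP g₀ h₁ h₂ hg₀
  choose U hsU hU using hloc
  have hcov : (⨆ s, U s) = ⊤ := top_le_iff.mp fun s _ ↦ Opens.mem_iSup.mpr ⟨s, hsU s⟩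
  refine IsZariskiLocalAtTarget.of_iSup_eq_top (fun s : S ↦ q ⁻¹ᵁ U s) ?_ hU
  rw [← Scheme.Hom.preimage_iSup, hcov, Scheme.Hom.preimage_top]

end Fibrewise

end Literature.AlgebraicGeometry.Morphisms
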